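import Mathlib
import Summits.Langlands.Langlands.Theses.PicardMuOrdinary

/-!
# Assembly of route PicardMuOrdinary (item stmt-Langlands-13763)

The assembly item of the route `PicardMuOrdinary` ("generic Picard curves `y³ = f(x)` over `ℚ` are
automorphic over `K = ℚ(ω)`") is the pure-logic implication

  `ResidualAutomorphyOdd → ResidualAutomorphyEven → MuOrdinaryFamilyRT → IrregularClassicality →
   SectorComplement → Langlands`,

i.e. verbatim the type of the route's deciding theorem
`Summit.Langlands.Langlands.Theses.PicardMuOrdinary.closes`.

Proof (the glue, spelled out rather than quoted, so that the file records the logical content):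
`SectorComplement : PicardAutomorphy → Langlands`, so it suffices to prove `PicardAutomorphy`.
Fix a quartic `f ∈ ℤ[X]` (separable, `12 ∣ #Gal(f)`) and a level datum `hcpt`.
`IrregularClassicality f hcpt …` turns the conclusion of `MuOrdinaryFamilyRT f hcpt …` (ρ_C is a
`3`-adic limit of regular algebraic cuspidal automorphic representations) into automorphy of the
Picard curve, and the residual hypothesis of `MuOrdinaryFamilyRT` is supplied by
`ResidualAutomorphyEven` when `f` has `4` real roots (`(f.map (Int.castRingHom ℝ)).roots.card = 4`)
and by `ResidualAutomorphyOdd` otherwise (`by_cases`).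

References: Boxer–Calegari–Gee–Pilloni (2025), *Modularity theorems for abelian surfaces*
(the shape residual automorphy ⟹ R = T in irregular weight ⟹ classicality); Buzzard–Gee (2014),
*The conjectural connections between automorphic representations and Galois representations*
(L-algebraic normalisation of the target).
-/

set_option linter.dupNamespace false -- project-wide option (lakefile weak.linter.dupNamespace); `Summit.Langlands.Langlands` is the mandated namespace

namespace Summit.Langlands.Langlands.Theorems

open Summit.Langlands.Langlands.Theses.PicardMuOrdinary in
/-- **Assembly of route `PicardMuOrdinary`** (item `stmt-Langlands-13763`): the four mathematical
items of the route and the sector junction `SectorComplement : PicardAutomorphy → Langlands` imply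
the summit statement `Langlands`. Pure logic: `SectorComplement` reduces the goal to
`PicardAutomorphy`; for each generic quartic `f` and level datum, `IrregularClassicality` applied to
the output of `MuOrdinaryFamilyRT`, whose residual-automorphy hypothesis is `ResidualAutomorphyEven`
if `f` has four real roots and `ResidualAutomorphyOdd` otherwise. This is exactly the route's
deciding theorem `Summit.Langlands.Langlands.Theses.PicardMuOrdinary.closes`. [folklore] -/
theorem picardMuOrdinary_assembly_proof :
    Summit.Langlands.Langlands.Theses.PicardMuOrdinary.Assembly := by
  unfold Summit.Langlands.Langlands.Theses.PicardMuOrdinary.Assembly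
  intro hOdd hEven hRT hCl hC
  refine hC ?_
  intro f hcpt hdeg hsep hgal
  refine hCl f hcpt hdeg hsep hgal (hRT f hcpt hdeg hsep hgal ?_)
  by_cases h4 : (f.map (Int.castRingHom ℝ)).roots.card = 4
  · exact hEven f hcpt hdeg hsep hgal h4
  · exact hOdd f hcpt hdeg hsep hgal h4

end Summit.Langlands.Langlands.Theorems
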